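import Literature.MathematicalPhysics.QuantumFieldTheory.Balaban1983to89.Node00.CarriersB8

/-!
# NODE 00 (YM-PLAN Track A) — THE CUMULATIVE STAGE-10 RECORD WITH THE [B8] GROUP PINNED AND ITS LEAF IN THE SURVIVING FORM: `IsRecordOfRecord₁₀CB10YZWB8`, its
# SAME-DATUM companion in `IsRecordOfRecord₁₀CB10YZW`, the five pinned leaves and what N05 ∕ N07 ∕ N08 read at such a record, by name

NODE 00 RECORD MODULE (seat `pub-ymgap-node00-def` g31, 2026-08-26), sequel of `Node00/CarriersB8` (the [B8] group of record `withB8OfRecord`, the residual layer `ResidB8`,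
the pin `Stage5Params.pinB8`, the S-binding `upOfRecord₅CS`) on top of `Node00/CarriersW` (`IsRecordOfRecord₁₀CB10YZW`, the four-pin view `view₁₀B10YZW`) and def-T's
`Node00/Record10` (`toStage5₁₀`, `Provisos₁₀`, `datumOfRecord₁₀`).  APPEND-ONLY: a NEW importing module; everything it reads is CONSUMED BY NAME.
[Balaban1985RegularSpaces] = T. Bałaban, Commun. Math. Phys. **99** (1985) 75–102 (cell paper B8); [Balaban1989LargeFieldII] = Commun. Math. Phys. **122** (1989) 355–392.

WHAT IS DEFINED.  `Stage9Params.pinB8` (+ `toStage5₁₀_pinB8 : rfl`, `Provisos₁₀.pinB8 ∕ of_pinB8` field by field incl. `contT`, `datumOfRecord₁₀_pinB8 : rfl`, `WOfRecord₁₀_pinB8 :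
rfl`); the FIVE-PIN VIEW `view₁₀B8B10YZW θ lam Mstar ops ζ lamW := (θ.pinB8 lam).view₁₀B10YZW Mstar ops ζ lamW` ([B8] innermost, so every earlier face is the earlier modules'
face at `θ.pinB8 lam` BY NAME); **`IsRecordOfRecord₁₀CB10YZWB8 D w`** := `IsRecordOfRecord₁₀CB10YZW` VERBATIM except that the world's upstream block is THE S-BINDING
`upOfRecord₅CS` at the five-pin view, for SOME residual [B8] layer `lam : ResidB8 θ.toStage3Params` (quantified with the record's parameters; no law assumed).

WHAT IS PROVED (kernel bookkeeping, 0 sorry).  (1) The leaves at the view: `b8 ↔ B8LeafOfRecord θ₃ lam` (`Iff.rfl`), `rBasicStep ∕ b9 ∕ b10 ∕ b11` = the four earlier faces; the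
C-binding's `b8` over the same view `↔ DagBinding.B8LeafR …` AS TYPED (`Iff.rfl`).  (2) Inhabitation = Stage 10's exactly (`exists_world_…`; `…_rebind_of_isRecordOfRecord₁₀C`).
(3) **THE SAME-DATUM COMPANION** (`companion_of_isRecordOfRecord₁₀CB10YZWB8`): a record of this module has THE SAME DATUM `D`, `C`, window and `L` as the `IsRecordOfRecord₁₀CB10YZW`
record at the world whose upstream block is the C-binding at the same view (witness `θ.pinB8 lam`), the two worlds' DAG leaves AGREE OFF `b8` (`leavesP w P = { leavesP w′ P with
b8 := … }`, by the plumbing lemma `leavesP_eq_of_up_withB8`), and the companion's `b8` (as typed) IMPLIES this record's (surviving) — never conversely.  HENCE: every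
datum-reading theorem over `₁₀CB10YZW ∕ ₁₀C ∕ ₅C` (binder nodes N23–N28, `IndAss`, flows) holds of `D` here; every node sentence NOT reading `b8` transfers along the leaf
equation by `rfl`; the nodes reading `b8` as an IN-EDGE (N07, N08, N09, N12, …) are STRONGER here by exactly «typed ⇒ surviving» (t4-dagwriter g79 (β): «the eventual
dischargers must confirm they need only the surviving members») — their closers FROM SLOTS port verbatim, their `atWorld` transfers do not.  (4) Faces: `leaves_iff_of_…`
(five leaves, one package), `leaf_b8_iff_of_…`, `b4_b5_b6_b7_of_…` (the in-edges are theorems of the record, via the companion), `b8_b11_b10_main_iff_of_…` (N05 IS «b9 → leaf»,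
N07 IS «leaf → b9 → b11», N08 IS «leaf → b9 → b11 → b10»), `nodes_iff_bundles_of_…` (the same at the bundles of record: `B8LeafOfRecord`, def-Y's `B9LeafX (Y9OfRecord …)`,
`B11Leaf (Z11OfRecord …)`, `PrintedUV3V`), `b8_main_of_…_of_slots` (N05's ∀-over-packages closer shape; a closer supplies `CarriersB8.b8LeafOfRecord_of_knit`).  (5) §2b
`exists_residB8_not_b8LeafOfRecord` — THE ∀-FORM IS JUNK-REFUTABLE through the residual Proposition-5 carriers (R433 species, kernel form; the `exists_residZ_not_b11Leaf` idiom):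
N05 is NOT bookable in ∀-form over this pin while `lan ∕ cub ∕ toAxial` are residual.

HONEST FRAMING: definitions + kernel bookkeeping; NO estimate; nothing of Bałaban's asserted; N05 ∕ N07 ∕ N08 NOT discharged; counts unmoved; one finite T⁴ programme at fixed ε
— NOT continuum ∕ ℝ⁴ ∕ infinite volume ∕ OS ∕ mass gap ∕ Clay.  No `sorry`, no `axiom`, no `opaque`, no `instance`, no `notation`. -/

noncomputable section

namespace Literature.MathematicalPhysics.QuantumFieldTheory.Balaban1983to89.Node00

open T4Continuum AveragingRT T4FiniteEpsInhabited FlowStep FlowStepRuns DagBinding T4DatumAssembly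
open B8LeafKnitRS (B8LeafRS)
open B8LeafModelZd (ZdIdx)
open B8Lemma1NonAbelian (blockPairNA)
open scoped Matrix.Norms.L2Operator

/-! ## §2b. The surviving leaf is JUNK-REFUTABLE through the residual layer (R433 species, kernel form) -/

section Junk

variable (θ : Stage3Params)

/-- **THE ∀-FORM IS JUNK-REFUTABLE THROUGH THE RESIDUAL [B8] LAYER** (kernel form of the honesty clause; the `CarriersZ.exists_residZ_not_b11Leaf` idiom): a residual layer
whose Proposition-5 family has ONE member with a satisfiable hypothesis (1.69) and NO Landau-gauge solutions at all (a DEGENERATE datum, not an object of record) makes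
the conjunct `p5e` — hence the leaf — FAIL.  So a pin of `lan` by the `R(U₀)`-carriers of record must precede any ∀-form booking of N05 over this pin.
[cite: Balaban1985RegularSpaces, Prop. 5 p.94 (bookkeeping: the typed existence clause reads the residual carriers)] -/
theorem exists_residB8_not_b8LeafOfRecord : ∃ lam : ResidB8 θ, ¬ B8LeafOfRecord θ lam := by
  obtain ⟨lam₀⟩ := nonempty_residB8 (θ := θ)
  refine ⟨{ lam₀ with I8c := PUnit, lan := fun _ => ⟨PUnit, PEmpty, fun _ _ _ => True, fun l => l.elim, fun _ l => l.elim⟩ }, fun h => ?_⟩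
  obtain ⟨c₂, hc₂, hE⟩ := h.p5e
  obtain ⟨l, -⟩ := hE PUnit.unit (c₂ / 2) (c₂ / 2) (by linarith) (by linarith) (by linarith) PUnit.unit trivial
  exact l.elim

end Junk

/-! ## §3. The cumulative Stage-10 record with the [B10], [B9], [B11], [IV] AND [B8] groups pinned, the `b8` leaf in its surviving form: `IsRecordOfRecord₁₀CB10YZWB8` -/

section Record10

variable (F : T4Family) (N : ℕ) [NeZero N]

/-- The [B8] pin of Stage-9 parameters (machine fields untouched). [cite: Balaban1985RegularSpaces, Thm 2 p.83 (bookkeeping)] -/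
def Stage9Params.pinB8 (θ : Stage9Params F N) (lam : ResidB8 θ.toStage3Params) : Stage9Params F N :=
  { θ with res := θ.res.pinB8 F N θ.toStage3Params lam }

/-- Admissibility is unchanged (`Iff.rfl`). [cite: Balaban1987RG1, (1.20)–(1.21) p.264 (hypothesis dictionary; bookkeeping)] -/
theorem Stage9Params.pinB8_admissible_iff (θ : Stage9Params F N) (lam : ResidB8 θ.toStage3Params) : (θ.pinB8 F N lam).Admissible ↔ θ.Admissible := Iff.rfl

/-- The Stage-10 view of [B8]-pinned parameters IS the [B8]-pinned Stage-10 view (`rfl`: `residualOfStage10` keeps `X`). [cite: Balaban1988Convergent, p.244 (bookkeeping)] -/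
theorem Stage9Params.toStage5₁₀_pinB8 (θ : Stage9Params F N) (lam : ResidB8 θ.toStage3Params) :
    (θ.pinB8 F N lam).toStage5₁₀ F N = (θ.toStage5₁₀ F N).pinB8 F N lam := rfl

/-- The [IV] bundle of record does not read the pinned group (`rfl`). [cite: Balaban1989LargeFieldI, (0.2) p.176 (bookkeeping)] -/
theorem WOfRecord₁₀_pinB8 (θ : Stage9Params F N) (lam : ResidB8 θ.toStage3Params) (lamW : ResidW F N) :
    WOfRecord₁₀ F N (θ.pinB8 F N lam) lamW = WOfRecord₁₀ F N θ lamW := rfl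

variable {F N} in
/-- The Stage-10 provisos read no carrier: they transport along the [B8] pin, field by field … [cite: Balaban1988Convergent, (3.2)–(3.9) pp.265–266; Balaban1987RG1, (0.19) p.255 (bookkeeping)] -/
theorem Stage9Params.Provisos₁₀.pinB8 {θ : Stage9Params F N} (h : θ.Provisos₁₀) (lam : ResidB8 θ.toStage3Params) : (θ.pinB8 F N lam).Provisos₁₀ :=
  ⟨h.intPiece, h.measω, h.measChi, h.zetaUnity, h.zetaAbs, fun p k _ hk => h.rstep p k hk, h.contT⟩

variable {F N} in
/-- … and back. [cite: Balaban1988Convergent, (3.2)–(3.9) pp.265–266 (bookkeeping)] -/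
theorem Stage9Params.Provisos₁₀.of_pinB8 {θ : Stage9Params F N} {lam : ResidB8 θ.toStage3Params} (h : (θ.pinB8 F N lam).Provisos₁₀) : θ.Provisos₁₀ :=
  ⟨h.intPiece, h.measω, h.measChi, h.zetaUnity, h.zetaAbs, fun p k _ hk => h.rstep p k hk, h.contT⟩

/-- THE PIN IS UP-SIDE at Stage 10: the datum of record is unchanged (`rfl`). [cite: Balaban1989LargeFieldII, Thm 1 + (0.1) pp.355–356 (bookkeeping)] -/
theorem datumOfRecord₁₀_pinB8 (θ : Stage9Params F N) (h : θ.Provisos₁₀) (lam : ResidB8 θ.toStage3Params) :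
    datumOfRecord₁₀ F N (θ.pinB8 F N lam) (h.pinB8 lam) = datumOfRecord₁₀ F N θ h := rfl

/-- **The cumulative pinned Stage-10 view with [B8]**: the four-pin view `view₁₀B10YZW` (floor `Mstar`, operator layer `ops`, [B11] layer `ζ`, [IV] layer `lamW`) OF THE
[B8]-PINNED parameters `θ.pinB8 lam` — the [B8] pin innermost, so every earlier face is the earlier modules' face at `θ.pinB8 lam` BY NAME.
[cite: Balaban1985RegularSpaces, Thm 2 p.83; Balaban1985UV3, Thm 1 p.257; Balaban1985BackgroundPropagators, Thm 3.1 p.397; Balaban1985Variational, Thm 1 p.279; Balaban1989LargeFieldI, (0.2) p.176 (objects of record)] -/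
def Stage9Params.view₁₀B8B10YZW (θ : Stage9Params F N) (lam : ResidB8 θ.toStage3Params) (Mstar : ℕ) (ops : OpsY N θ.toStage3Params Mstar) (ζ : ResidZ F N)
    (lamW : ResidW F N) : Stage5Params F N :=
  (θ.pinB8 F N lam).view₁₀B10YZW F N Mstar ops ζ lamW

/-- **The leaves of the S-binding over the cumulative view, by name**: `b8 ↔ B8LeafOfRecord θ₃ lam` (THIS module's face), `rBasicStep ↔ B15Leaf (WOfRecord₁₀ θ lamW P)`,
`b9 ↔ B9LeafX (Y9OfRecord …)`, `b10 ↔ PrintedUV3V N θ.L`, `b11 ↔ B11Leaf (Z11OfRecord F N ζ)` (the four earlier faces at `θ.pinB8 lam`).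
[cite: Balaban1985RegularSpaces, Lemma 1 – Thm 8 pp.79–101; Balaban1989LargeFieldI, Prop. 1 p.194; Balaban1985BackgroundPropagators, Thm 3.1 p.397; Balaban1985UV3, Thm 1 p.257; Balaban1985Variational, Thm 1 p.279] -/
theorem upOfRecord₅CS_view₁₀B8B10YZW_leaves (θ : Stage9Params F N) (lam : ResidB8 θ.toStage3Params) (Mstar : ℕ) (ops : OpsY N θ.toStage3Params Mstar)
    (ζ : ResidZ F N) (lamW : ResidW F N) (P : B12.RunParams) :
    ((upOfRecord₅CS F N (θ.view₁₀B8B10YZW F N lam Mstar ops ζ lamW) P).b8 ↔ B8LeafOfRecord θ.toStage3Params lam) ∧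
    ((upOfRecord₅CS F N (θ.view₁₀B8B10YZW F N lam Mstar ops ζ lamW) P).rBasicStep ↔ B15Leaf (WOfRecord₁₀ F N θ lamW P)) ∧
    ((upOfRecord₅CS F N (θ.view₁₀B8B10YZW F N lam Mstar ops ζ lamW) P).b9 ↔ B9LeafX (Y9OfRecord N θ.toStage3Params Mstar ops)) ∧
    ((upOfRecord₅CS F N (θ.view₁₀B8B10YZW F N lam Mstar ops ζ lamW) P).b10 ↔ PrintedUV3V N θ.L) ∧
    ((upOfRecord₅CS F N (θ.view₁₀B8B10YZW F N lam Mstar ops ζ lamW) P).b11 ↔ B11Leaf (Z11OfRecord F N ζ)) :=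
  ⟨Iff.rfl, upOfRecord₅C_view₁₀B10YZW_leaves F N (θ.pinB8 F N lam) Mstar ops ζ lamW P⟩

/-- … and the C-binding's `b8` leaf over the same view is the leaf AS TYPED (`DagBinding.B8LeafR`, `t8 := Thm8PrintedAt 1`) at the group of record (`Iff.rfl`) — the
companion world's `b8` below. [cite: Balaban1985RegularSpaces, Lemma 1 – Thm 8 pp.79–101 (the typed leaf; bookkeeping)] -/
theorem upOfRecord₅C_view₁₀B8B10YZW_b8_iff (θ : Stage9Params F N) (lam : ResidB8 θ.toStage3Params) (Mstar : ℕ) (ops : OpsY N θ.toStage3Params Mstar)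
    (ζ : ResidZ F N) (lamW : ResidW F N) (P : B12.RunParams) :
    (upOfRecord₅C F N (θ.view₁₀B8B10YZW F N lam Mstar ops ζ lamW) P).b8 ↔
      B8LeafR θ.D (θ.L : ℝ) lam.C₂ lam.B₁' lam.inp.B₀' lam.B₁ lam.B₂ lam.c₁ lam.inp lam.B₀β (blockPairNA θ.D θ.L θ.𝔸)
        (famB8OfRecord θ.toStage3Params lam.β lam.len) lam.lan lam.cub lam.toAxial :=
  Iff.rfl

/-- **«(D, w) is the record, Stage 10, [B10] ∕ [B9] ∕ [B11] ∕ [IV] AND [B8] groups pinned, `b8` in its surviving form»** (CUMULATIVE): for some admissible Stage-9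
parameter `θ` with its Stage-10 provisos, SOME residual [B8] layer `lam` and the four earlier residual layers, `D` is the datum of record at `θ` and the world's upstream
block is THE S-BINDING at the five-pin view.  The residual layers are quantified WITH the record's parameters; no law on them is assumed.
[cite: Balaban1985RegularSpaces, Lemma 1 – Thm 8 pp.79–101; Balaban1989LargeFieldII, Thm 1 + (0.1) pp.355–356 (objects of record)] -/
def IsRecordOfRecord₁₀CB10YZWB8 (D : FiniteEpsData F (SU N)) (w : WorldP) : Prop :=
  ∃ (θ : Stage9Params F N) (h : θ.Provisos₁₀) (lam : ResidB8 θ.toStage3Params) (Mstar : ℕ) (ops : OpsY N θ.toStage3Params Mstar) (ζ : ResidZ F N)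
    (lamW : ResidW F N),
    θ.Admissible ∧ D = datumOfRecord₁₀ F N θ h ∧ w.C = D.C ∧ (0 < w.γ ∧ w.γ ≤ θ.γ) ∧ w.L = (θ.L : ℝ) ∧
      ∀ P : B12.RunParams, w.up P = upOfRecord₅CS F N (θ.view₁₀B8B10YZW F N lam Mstar ops ζ lamW) P

/-- **Inhabitation is Stage 10's EXACTLY**: every admissible Stage-9 parameter with its Stage-10 provisos and ANY five residual layers give a record of this module at
some world, any window `0 < γw ≤ θ.γ` (all five residual types are inhabited: `nonempty_residB8`, def-Y's ops witness, `nonempty_residZ`, `nonempty_residW`).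
[cite: Balaban1989LargeFieldII, Thm 1 + (0.1) pp.355–356 (bookkeeping)] -/
theorem exists_world_isRecordOfRecord₁₀CB10YZWB8 (θ : Stage9Params F N) (h : θ.Provisos₁₀) (hθ : θ.Admissible) (lam : ResidB8 θ.toStage3Params) (Mstar : ℕ)
    (ops : OpsY N θ.toStage3Params Mstar) (ζ : ResidZ F N) (lamW : ResidW F N) {γw : ℝ} (hγw : 0 < γw ∧ γw ≤ θ.γ) :
    ∃ w : WorldP, IsRecordOfRecord₁₀CB10YZWB8 F N (datumOfRecord₁₀ F N θ h) w ∧ w.γ = γw := by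
  obtain ⟨w₀, -, -⟩ := exists_world_isRecordOfRecord₁₀C F N θ h hθ hγw
  exact ⟨{ w₀ with
      C := (datumOfRecord₁₀ F N θ h).C, γ := γw, L := (θ.L : ℝ), one_lt_L := by exact_mod_cast θ.hL.2,
      up := fun P => upOfRecord₅CS F N (θ.view₁₀B8B10YZW F N lam Mstar ops ζ lamW) P },
    ⟨θ, h, lam, Mstar, ops, ζ, lamW, hθ, rfl, rfl, hγw, rfl, fun _ => rfl⟩, rfl⟩

variable {F N}
variable {D : FiniteEpsData F (SU N)} {w : WorldP}

/-- Plumbing: if a world's upstream block is, run by run, a fixed block with `b8` re-bound, its DAG leaves are that block's world's leaves with `b8` re-bound — every node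
sentence not reading `b8` transfers along this equation by `rfl`. [cite: Balaban1985RegularSpaces, Lemma 1 – Thm 8 pp.79–101 (leaf re-binding; bookkeeping)] -/
theorem leavesP_eq_of_up_withB8 {u : B12.RunParams → Upstream} {b : B12.RunParams → Prop} (hup : ∀ P, w.up P = (u P).withB8 (b P)) (P : B12.RunParams) :
    leavesP w P = { leavesP { w with up := u } P with b8 := b P } := by
  unfold leavesP
  rw [hup P]
  rfl

/-- **THE SAME-DATUM COMPANION IN `IsRecordOfRecord₁₀CB10YZW`**: a record of this module has THE SAME DATUM, the same `C`, window and block size as the Stage-10 record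
(four groups pinned) at the world whose `b8` leaf is bound AS TYPED over the [B8]-pinned carriers (witness `θ.pinB8 lam`); the two worlds' leaves agree off `b8`, and
the companion's `b8` (as typed) implies this record's (surviving) — never conversely.  So every DATUM-reading theorem and every node sentence not downstream of `b8` transfers;
the nodes reading `b8` as an in-edge (N07, N08, N09, …) are STRONGER here by exactly «typed ⇒ surviving» and their closers-from-slots port verbatim (§ faces below).
[cite: Balaban1985RegularSpaces, Thm 8 p.101 (surviving vs typed, GAPS G-B8-13); Balaban1989LargeFieldII, Thm 1 + (0.1) pp.355–356 (bookkeeping)] -/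
theorem companion_of_isRecordOfRecord₁₀CB10YZWB8 (h : IsRecordOfRecord₁₀CB10YZWB8 F N D w) :
    ∃ w' : WorldP, IsRecordOfRecord₁₀CB10YZW F N D w' ∧ w'.C = w.C ∧ w'.γ = w.γ ∧ w'.L = w.L ∧
      (∀ P : B12.RunParams, leavesP w P = { leavesP w' P with b8 := (leavesP w P).b8 }) ∧
      ∀ P : B12.RunParams, (leavesP w' P).b8 → (leavesP w P).b8 := by
  obtain ⟨θ, hP, lam, Mstar, ops, ζ, lamW, hθ, hD, hC, hγ, hL, hup⟩ := h
  have hup' : ∀ P, w.up P = (upOfRecord₅C F N (θ.view₁₀B8B10YZW F N lam Mstar ops ζ lamW) P).withB8 (leavesP w P).b8 := fun P => by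
    show w.up P = (upOfRecord₅C F N _ P).withB8 (w.up P).b8
    rw [hup P]
    rfl
  refine ⟨{ w with up := fun P => upOfRecord₅C F N (θ.view₁₀B8B10YZW F N lam Mstar ops ζ lamW) P },
    ⟨θ.pinB8 F N lam, hP.pinB8 lam, Mstar, ops, ζ, lamW, hθ, ?_, hC, hγ, hL, fun P => rfl⟩, rfl, rfl, rfl, leavesP_eq_of_up_withB8 hup', fun P h8 => ?_⟩
  · rw [datumOfRecord₁₀_pinB8]; exact hD
  · have h8' := (upOfRecord₅C_view₁₀B8B10YZW_b8_iff F N θ lam Mstar ops ζ lamW P).1 h8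
    show (w.up P).b8
    rw [hup P]
    exact (upOfRecord₅CS_view₁₀B8B10YZW_leaves F N θ lam Mstar ops ζ lamW P).1.2
      (B8LeafKnitRS.b8LeafRS_of_b8LeafR (C136_C162_famB8OfRecord lam.β lam.len) h8')

/-- **THE FIVE PINNED LEAVES AT A RECORD OF THIS MODULE, for ONE parameter package**. [cite: Balaban1985RegularSpaces, Lemma 1 – Thm 8 pp.79–101; Balaban1989LargeFieldI, Prop. 1 p.194; Balaban1985BackgroundPropagators, Thm 3.1 p.397; Balaban1985UV3, Thm 1 p.257; Balaban1985Variational, Thm 1 p.279] -/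
theorem leaves_iff_of_isRecordOfRecord₁₀CB10YZWB8 (h : IsRecordOfRecord₁₀CB10YZWB8 F N D w) :
    ∃ (θ : Stage9Params F N) (lam : ResidB8 θ.toStage3Params) (Mstar : ℕ) (ops : OpsY N θ.toStage3Params Mstar) (ζ : ResidZ F N) (lamW : ResidW F N),
      θ.Admissible ∧ w.L = (θ.L : ℝ) ∧ ∀ P : B12.RunParams,
        ((leavesP w P).b8 ↔ B8LeafOfRecord θ.toStage3Params lam) ∧ ((leavesP w P).rBasicStep ↔ B15Leaf (WOfRecord₁₀ F N θ lamW P)) ∧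
        ((leavesP w P).b9 ↔ B9LeafX (Y9OfRecord N θ.toStage3Params Mstar ops)) ∧ ((leavesP w P).b10 ↔ PrintedUV3V N θ.L) ∧
        ((leavesP w P).b11 ↔ B11Leaf (Z11OfRecord F N ζ)) := by
  obtain ⟨θ, -, lam, Mstar, ops, ζ, lamW, hθ, -, -, -, hL, hup⟩ := h
  refine ⟨θ, lam, Mstar, ops, ζ, lamW, hθ, hL, fun P => ?_⟩
  have hl := upOfRecord₅CS_view₁₀B8B10YZW_leaves F N θ lam Mstar ops ζ lamW P
  refine ⟨?_, ?_, ?_, ?_, ?_⟩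
  · show (w.up P).b8 ↔ _
    rw [hup P]; exact hl.1
  · show (w.up P).rBasicStep ↔ _
    rw [hup P]; exact hl.2.1
  · show (w.up P).b9 ↔ _
    rw [hup P]; exact hl.2.2.1
  · show (w.up P).b10 ↔ _
    rw [hup P]; exact hl.2.2.2.1
  · show (w.up P).b11 ↔ _
    rw [hup P]; exact hl.2.2.2.2

/-- **THE `b8` LEAF AT A RECORD OF THIS MODULE IS THE SURVIVING LEAF AT THE GROUP OF RECORD** for the record's residual [B8] layer.
[cite: Balaban1985RegularSpaces, Lemma 1 – Thm 8 pp.79–101 (Thm 8 surviving)] -/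
theorem leaf_b8_iff_of_isRecordOfRecord₁₀CB10YZWB8 (h : IsRecordOfRecord₁₀CB10YZWB8 F N D w) :
    ∃ (θ : Stage9Params F N) (lam : ResidB8 θ.toStage3Params), θ.Admissible ∧ ∀ P : B12.RunParams, (leavesP w P).b8 ↔ B8LeafOfRecord θ.toStage3Params lam := by
  obtain ⟨θ, lam, Mstar, ops, ζ, lamW, hθ, -, hl⟩ := leaves_iff_of_isRecordOfRecord₁₀CB10YZWB8 h
  exact ⟨θ, lam, hθ, fun P => (hl P).1⟩

/-- The in-edges `b4 b5 b6 b7` are THEOREMS at a record of this module (Stages 1–2 and N03 at the companion, transported off `b8`).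
[cite: Balaban1983RegularityDecay, Thm p.573; Balaban1984PropagatorsI, Props. 1.1–1.2 pp.33–36; Balaban1984PropagatorsII, pp.223–250; Balaban1985Averaging, Props. 1–10 pp.26–50 (bookkeeping: the discharged in-edges at the record)] -/
theorem b4_b5_b6_b7_of_isRecordOfRecord₁₀CB10YZWB8 (h : IsRecordOfRecord₁₀CB10YZWB8 F N D w) (P : B12.RunParams) :
    (leavesP w P).b4 ∧ (leavesP w P).b5 ∧ (leavesP w P).b6 ∧ (leavesP w P).b7 := by
  obtain ⟨w', hw', -, -, -, hleaves, -⟩ := companion_of_isRecordOfRecord₁₀CB10YZWB8 h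
  have h' : (leavesP w' P).b4 ∧ (leavesP w' P).b5 ∧ (leavesP w' P).b6 ∧ (leavesP w' P).b7 :=
    atWorld_of_isRecordOfRecord₁₀CB10YZW (X := fun ℓ => ℓ.b4 ∧ ℓ.b5 ∧ ℓ.b6 ∧ ℓ.b7)
      (fun _ _ h5 P =>
        have h4 := b4_main_of_isRecordOfRecord₅C h5 P
        have hb5 := b5_main_of_isRecordOfRecord₅C h5 P h4
        ⟨h4, hb5, N03_at_record₅C h5 P h4 hb5, b7_main_of_isRecordOfRecord₅C h5 P hb5⟩) hw' P
  rw [hleaves P]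
  exact h'

/-- **N05 AT A RECORD OF THIS MODULE IS «b9 → the surviving leaf at the group of record»**, N07 IS «leaf → b9 → b11», N08 IS «leaf → b9 → b11 → b10» — the in-edges
`b5 b6 b7` being theorems of the record. [cite: Balaban1985RegularSpaces, Thm 2 p.83, Thm 4 p.88, Thm 8 p.101 (node N05); Balaban1985Variational, Thm 1 p.279 (N07); Balaban1985UV3, Thm 1 p.257 (N08) (bookkeeping: the nodes at a record)] -/
theorem b8_b11_b10_main_iff_of_isRecordOfRecord₁₀CB10YZWB8 (h : IsRecordOfRecord₁₀CB10YZWB8 F N D w) (P : B12.RunParams) :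
    (Dag.B8_main (leavesP w P) ↔ ((leavesP w P).b9 → (leavesP w P).b8)) ∧
    (Dag.B11_main (leavesP w P) ↔ ((leavesP w P).b8 → (leavesP w P).b9 → (leavesP w P).b11)) ∧
    (Dag.B10_main (leavesP w P) ↔ ((leavesP w P).b8 → (leavesP w P).b9 → (leavesP w P).b11 → (leavesP w P).b10)) := by
  obtain ⟨-, h5, h6, h7⟩ := b4_b5_b6_b7_of_isRecordOfRecord₁₀CB10YZWB8 h P
  exact ⟨⟨fun hN h9 => hN h5 h6 h7 h9, fun hN _ _ _ => hN⟩, ⟨fun hN h8 h9 => hN h5 h6 h7 h8 h9, fun hN _ _ _ => hN⟩,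
    ⟨fun hN h8 h9 h11 => hN h5 h6 h7 h8 h9 h11, fun hN _ _ _ => hN⟩⟩

/-- **N05 ∕ N07 ∕ N08 AT THE BUNDLES OF RECORD, for ONE parameter package**: at every run `Dag.B8_main ↔ (B9LeafX (Y9OfRecord …) → B8LeafOfRecord θ₃ lam)`,
`Dag.B11_main ↔ (B8LeafOfRecord θ₃ lam → B9LeafX (Y9OfRecord …) → B11Leaf (Z11OfRecord F N ζ))`, `Dag.B10_main ↔ (B8LeafOfRecord θ₃ lam → B9LeafX … → B11Leaf … → PrintedUV3V N θ.L)`.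
[cite: Balaban1985RegularSpaces, Thm 2 p.83, Thm 8 p.101; Balaban1985Variational, Thm 1 p.279; Balaban1985UV3, Thm 1 p.257 + Thm 2 p.272 (the nodes at the objects of record)] -/
theorem nodes_iff_bundles_of_isRecordOfRecord₁₀CB10YZWB8 (h : IsRecordOfRecord₁₀CB10YZWB8 F N D w) :
    ∃ (θ : Stage9Params F N) (lam : ResidB8 θ.toStage3Params) (Mstar : ℕ) (ops : OpsY N θ.toStage3Params Mstar) (ζ : ResidZ F N), θ.Admissible ∧ w.L = (θ.L : ℝ) ∧
      ∀ P : B12.RunParams,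
        (Dag.B8_main (leavesP w P) ↔ (B9LeafX (Y9OfRecord N θ.toStage3Params Mstar ops) → B8LeafOfRecord θ.toStage3Params lam)) ∧
        (Dag.B11_main (leavesP w P) ↔
          (B8LeafOfRecord θ.toStage3Params lam → B9LeafX (Y9OfRecord N θ.toStage3Params Mstar ops) → B11Leaf (Z11OfRecord F N ζ))) ∧
        (Dag.B10_main (leavesP w P) ↔
          (B8LeafOfRecord θ.toStage3Params lam → B9LeafX (Y9OfRecord N θ.toStage3Params Mstar ops) → B11Leaf (Z11OfRecord F N ζ) → PrintedUV3V N θ.L)) := by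
  obtain ⟨θ, lam, Mstar, ops, ζ, lamW, hθ, hL, hl⟩ := leaves_iff_of_isRecordOfRecord₁₀CB10YZWB8 h
  refine ⟨θ, lam, Mstar, ops, ζ, hθ, hL, fun P => ?_⟩
  obtain ⟨h8, h11, h10⟩ := b8_b11_b10_main_iff_of_isRecordOfRecord₁₀CB10YZWB8 h P
  rw [h8, h11, h10, (hl P).1, (hl P).2.2.1, (hl P).2.2.2.1, (hl P).2.2.2.2]
  exact ⟨Iff.rfl, Iff.rfl, Iff.rfl⟩

/-- **N05 «SLOTS» FORM at a record of this module**: if for every parameter package presenting `(D, w)` as a record of this module the surviving leaf holds at the group of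
record, then `Dag.B8_main` holds at every run (in-edges unused).  The hypothesis quantifies over the HIDDEN residual layer — honest, and why N05 is not bookable in ∀-form
while five of its nine conjuncts read residual data; `b8LeafOfRecord_of_knit` is the shape a closer supplies. [cite: Balaban1985RegularSpaces, Lemma 1 – Thm 8 pp.79–101 (the node's shape `Dag.B8_main`, bookkeeping)] -/
theorem b8_main_of_isRecordOfRecord₁₀CB10YZWB8_of_slots (h : IsRecordOfRecord₁₀CB10YZWB8 F N D w)
    (hB : ∀ (θ : Stage9Params F N) (hP : θ.Provisos₁₀) (lam : ResidB8 θ.toStage3Params) (Mstar : ℕ) (ops : OpsY N θ.toStage3Params Mstar) (ζ : ResidZ F N)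
      (lamW : ResidW F N), θ.Admissible → D = datumOfRecord₁₀ F N θ hP →
        (∀ P, w.up P = upOfRecord₅CS F N (θ.view₁₀B8B10YZW F N lam Mstar ops ζ lamW) P) → B8LeafOfRecord θ.toStage3Params lam)
    (P : B12.RunParams) : Dag.B8_main (leavesP w P) := by
  obtain ⟨θ, hP, lam, Mstar, ops, ζ, lamW, hθ, hD, -, -, -, hup⟩ := h
  intro _ _ _ _
  show (w.up P).b8
  rw [hup P]
  exact (upOfRecord₅CS_view₁₀B8B10YZW_leaves F N θ lam Mstar ops ζ lamW P).1.2 (hB θ hP lam Mstar ops ζ lamW hθ hD hup)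

/-- Conversely, RE-BINDING a `₁₀C` record's world by the S-binding at the five-pin view (any residual layers) gives a record of this module with the SAME datum.
[cite: Balaban1989LargeFieldII, Thm 1 p.355 (bookkeeping)] -/
theorem isRecordOfRecord₁₀CB10YZWB8_rebind_of_isRecordOfRecord₁₀C (h : IsRecordOfRecord₁₀C F N D w) :
    ∃ (θ : Stage9Params F N) (_ : θ.Provisos₁₀), θ.Admissible ∧ (∀ P, w.up P = upOfRecord₅C F N (θ.toStage5₁₀ F N) P) ∧
      ∀ (lam : ResidB8 θ.toStage3Params) (Mstar : ℕ) (ops : OpsY N θ.toStage3Params Mstar) (ζ : ResidZ F N) (lamW : ResidW F N),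
        IsRecordOfRecord₁₀CB10YZWB8 F N D { w with up := fun P => upOfRecord₅CS F N (θ.view₁₀B8B10YZW F N lam Mstar ops ζ lamW) P } := by
  obtain ⟨θ, hP, hθ, hD, hC, hγ, hL, hup⟩ := h
  exact ⟨θ, hP, hθ, hup, fun lam Mstar ops ζ lamW => ⟨θ, hP, lam, Mstar, ops, ζ, lamW, hθ, hD, hC, hγ, hL, fun _ => rfl⟩⟩

end Record10

end Literature.MathematicalPhysics.QuantumFieldTheory.Balaban1983to89.Node00

end
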